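import Literature.Analysis.FluidPDE.MildSolution
import Literature.Analysis.UnboundedOperators.HeatKernelStrongContinuityProofs
import HarnessLib

/-!
# The heat semigroup `heatFlow` for all `τ ≥ 0`: discharge of the four named facts of `MildSolution.lean`

Sibling proof file of `Literature/Analysis/FluidPDE/MildSolution.lean` (D-0014: named facts
`def X : Prop` are discharged as `theorem X_holds : X`). The accepted `Literature.Fluid.heatFlow φ τ`
is the caloric extension `heatExtension φ τ = heatKernel τ ⋆ φ` for `0 < τ` and `φ` itself for
`τ ≤ 0` (`e^{0Δ} = id`). The four facts below were demoted from interim proofs that relied on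
then-unproved heat-kernel facts; those ingredients are now all discharged in the tree
(`heatExtension_add_holds`, `memLp_heatExtension_holds`, `eLpNorm_heatExtension_le_holds` in
`HeatKernel.lean`, `tendsto_heatExtension_nhdsWithin_zero_holds` in
`HeatKernelStrongContinuityProofs.lean`), so the interim proofs go through verbatim:

* `Literature.Analysis.FluidPDE.heatFlow_heatFlow_holds` — semigroup law `e^{tΔ}e^{sΔ}f = e^{(s+t)Δ}f`, `f ∈ L^p`,
  `1 ≤ p`, `0 ≤ s, t` (Evans, *PDE*, §2.3.1);
* `Literature.Analysis.FluidPDE.memLp_heatFlow_holds` — `e^{tΔ}f ∈ L^p` for `f ∈ L^p`, `0 ≤ t`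
  (Giga–Giga–Saal 2010, §1.1.2);
* `Literature.Analysis.FluidPDE.eLpNorm_heatFlow_le_holds` — `‖e^{tΔ}f‖_p ≤ ‖f‖_p`, `0 ≤ t`
  (Giga–Giga–Saal 2010, §1.1.2);
* `Literature.Analysis.FluidPDE.tendsto_heatFlow_nhdsWithin_zero_holds` — `‖e^{tΔ}f - f‖_p → 0` as `t → 0`,
  `t ≥ 0`, for `f ∈ L^p`, `1 ≤ p < ∞` (Stein, *Singular Integrals*, Ch. III §2, Thm. 2;
  Evans, *PDE*, §2.3.1, Thm. 1 (iii)).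

## References

* L. C. Evans, *Partial Differential Equations*, 2nd ed. (AMS 2010), §2.3.1, Thm. 1.
  Bib key `Evans2010`.
* M.-H. Giga, Y. Giga, J. Saal, *Nonlinear Partial Differential Equations* (Birkhäuser 2010),
  §1.1.2. Bib key `GigaGigaSaal2010`.
* E. M. Stein, *Singular Integrals and Differentiability Properties of Functions* (1970),
  Ch. III §2, Thm. 2. Bib key `SteinSingularIntegrals1970`.
-/

noncomputable section

open MeasureTheory TopologicalSpace Set Function Filter Topology
open scoped ENNReal NNReal

namespace Literature.Analysis.FluidPDE

variable {E : Type*} [NormedAddCommGroup E] [InnerProductSpace ℝ E] [FiniteDimensional ℝ E]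
  [MeasurableSpace E] [BorelSpace E]
variable {F : Type*} [NormedAddCommGroup F] [NormedSpace ℝ F]

/-- **Discharge of `heatFlow_heatFlow`**: the semigroup law `e^{tΔ}(e^{sΔ}f) = e^{(s+t)Δ}f` for
`f ∈ L^p`, `1 ≤ p`, and all `0 ≤ s, t` — the accepted `heatExtension_add_holds` for `0 < s, t`,
the cases `s = 0` or `t = 0` being definitional (`heatFlow_zero`). Evans, *PDE*, §2.3.1.
[cite: Evans2010, §2.3.1] -/
theorem heatFlow_heatFlow_holds : heatFlow_heatFlow (E := E) (F := F) := by
  intro _ f p hf hp s t hs ht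
  rcases hs.eq_or_lt with rfl | hs
  · simp
  rcases ht.eq_or_lt with rfl | ht
  · simp
  rw [heatFlow_of_pos _ hs, heatFlow_of_pos _ ht, heatFlow_of_pos _ (add_pos hs ht),
    UnboundedOperators.heatExtension_add_holds hf hp hs ht]

/-- **Discharge of `memLp_heatFlow`**: `e^{tΔ}f ∈ L^p` for `f ∈ L^p`, `1 ≤ p`, `0 ≤ t`
(`memLp_heatExtension_holds` for `0 < t`; `t = 0` is `f` itself). Giga–Giga–Saal 2010, §1.1.2.
[cite: GigaGigaSaal2010, §1.1.2] -/
theorem memLp_heatFlow_holds : memLp_heatFlow (E := E) (F := F) := by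
  intro _ f p hf hp t ht
  rcases ht.eq_or_lt with rfl | ht
  · simpa using hf
  rw [heatFlow_of_pos _ ht]
  exact UnboundedOperators.memLp_heatExtension_holds hf hp ht

/-- **Discharge of `eLpNorm_heatFlow_le`**: the `L^p` contraction `‖e^{tΔ}f‖_p ≤ ‖f‖_p` for
`f ∈ L^p`, `1 ≤ p`, `0 ≤ t` (`eLpNorm_heatExtension_le_holds` for `0 < t`; equality at `t = 0`).
Giga–Giga–Saal 2010, §1.1.2. [cite: GigaGigaSaal2010, §1.1.2] -/
theorem eLpNorm_heatFlow_le_holds : eLpNorm_heatFlow_le (E := E) (F := F) := by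
  intro _ f p hf hp t ht
  rcases ht.eq_or_lt with rfl | ht
  · simp
  rw [heatFlow_of_pos _ ht]
  exact UnboundedOperators.eLpNorm_heatExtension_le_holds hf hp ht

/-- **Discharge of `tendsto_heatFlow_nhdsWithin_zero`**: strong continuity at `t = 0` from the
right *including* `t = 0`: for `f ∈ L^p`, `1 ≤ p < ∞`, `‖e^{tΔ}f - f‖_p → 0` as `t → 0`, `t ≥ 0`
(the accepted `tendsto_heatExtension_nhdsWithin_zero_holds` on `t > 0`, and the value `0` at
`t = 0` since `heatFlow f 0 = f`). Stein, *Singular Integrals*, Ch. III §2, Thm. 2; Evans, *PDE*,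
§2.3.1, Thm. 1 (iii). [cite: SteinSingularIntegrals1970, Ch. III §2 Theorem 2] -/
theorem tendsto_heatFlow_nhdsWithin_zero_holds :
    tendsto_heatFlow_nhdsWithin_zero (E := E) (F := F) := by
  intro _ f p hf hp hp'
  have h : Tendsto (fun t : ℝ => eLpNorm (heatFlow f t - f) p volume) (𝓝[>] 0) (𝓝 0) :=
    (UnboundedOperators.tendsto_heatExtension_nhdsWithin_zero_holds hf hp hp').congr'
      (eventually_nhdsWithin_of_forall fun t ht => by
        simp only [heatFlow_of_pos f (mem_Ioi.1 ht)])
  rw [← Ioi_insert, nhdsWithin_insert, tendsto_sup]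
  exact ⟨by simpa using tendsto_pure_nhds (fun t : ℝ => eLpNorm (heatFlow f t - f) p volume) 0, h⟩

end Literature.Analysis.FluidPDE
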